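import Summits.QuantumFields.YangMills.Theorems.BalabanUVNodesN07CritCfgAxOfRecordClauses
import Summits.QuantumFields.YangMills.Theorems.BalabanUVNodesK0TwoPrimeOfLipschitzCollar
import Literature.MathematicalPhysics.QuantumFieldTheory.Balaban1983to89.Node00.Record13Ax

/-!
# K0 road, Ax EDITION — THE SINGLE-LEVEL RIDER, THE PER-LEVEL COLLAR AND THE `εreg`-CONGRUENCE RE-CENTRED AT RC-1's NAMED `critCfgAxOfRecord` ∕ `chiFix29AxOfRecord`
# (the three Summits-side Ax twins this seat's one-radius doors read — SIGMA-CLOSURE finding (5), OP 5a supplier)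

Cell `pub-ymgap` (YM-PLAN Track A, D-0062), width seat `pub-ymgap-dag-n07-w3` (g22; node N07 = [Balaban1985Variational] ∕ K0–K1 junction; dag-lead g40 WORDS 576∕578: OP 5a supplier).
`--kind proof --supports stmt-QuantumFields-27238 --as helper` (K0ᴬ `Record13SepCoPHInhabitedAx`, the live re-centred K0 crux since route rev 31∕32 — the item these doors serve), COUNT-NEUTRAL.  NEW leaf; THEOREMS ONLY — 0 `def`, 0 `sorry`, 0 `instance`, 0 `notation`; standard axioms.
[I] = [Balaban1987RG1] (CMP 109), [B7] = [Balaban1985Averaging] (CMP 98), [B11] = [Balaban1985Variational] (CMP 102).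

WHY.  This seat's one-radius K0 doors (g19–g21: `…K0Beta13RadiusBlind{,FirstForm,Guarded}`, `…K0TwoPrime…`, `…K0CompCofinalRadii…`) run a read-set induction on β whose rows at the
choice-centred (2.9) cut-off are supplied by three Summits-side lemmas that READ THE CENTRE: the single-level RIDER `hb0_at_of_hsol_of_numerics` (distinguished bond variables follow the
others, [I] p. 266–267), the per-level COLLAR `firstForm_of_chiFix29_of_lipschitz` (a field in the support of `χ^{(2.9)}` over a first-form average is first-form, from [15] Prop. 9's
Lipschitz row), and `chiFix29OfRecord_congr_εreg` (the cut-off reads its numerics carrier only through `εreg`).  My σ-closure census (`SIGMA-CLOSURE-K0-V23-Ax.g22.md`, evidence on K0ᴬ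
stmt-QuantumFields-27238) lists exactly these three as the Summits-side statement-level twins my lane owes for the Ax re-issue of the doors (the member β-blindness ✓p797544, the selector
congruence `chiFixed29Ax_congr_of_Uk_eq` ✓p797544 and Prop-2 smallness ✓p798981 exist).  THIS FILE supplies them for RC-1's NAMED objects ([Ax-2] `critCfgAxOfRecord`,
`fluctDevAxOfRecord`, `chiFix29AxOfRecord`, `chiFixed29Ax`; [Ax-3a] `chiβOfRecord₁₃Ax`):
* §1 `critCfgAxOfRecord_congr_εreg` ∕ `fluctDevAxOfRecord_congr_εreg` ∕ ★ `chiFix29AxOfRecord_congr_εreg` ∕ `chiFixed29Ax_congr_εreg` (definitional: the named centre reads `ν` only through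
  `Uk … ν.εreg`).
* §2 ★★ `fluctDevAx_b0_le_of_chiFix29Ax_eq_one` — THE Ax RIDER from dag-n09-w3 g6's letter-parametric rider `dist1_b0_le_of_thresholds` at `crit := critCfgAxOfRecord ν K k`: for `k < K`,
  `U` with `UkExists (k+1) ν.εreg (Ū U)` and `χ^{(2.9)}_{k,ax}(U) = 1` (threshold `ε₁ ≥ 0`), under the rider numerics at `δ := 2εreg∕L²` and the (53) pair at `εreg`, every distinguished bond
  has `fluctDevAx U b ≤ 10·((d+2)L)·ε₁·L^{d−1}` (fibre identity `avg_critCfgAxOfRecord` + Prop-2 smallness of the named letter, file 1); ★★ `hb0Ax_at_of_hsol_of_numerics` — the same in the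
  Stage-13 currency of g21's `hb0_at_of_hsol_of_numerics` (`chiβOfRecord₁₃Ax F N θ₀ K g j U = 1`).
* §3 `firstForm_gaugeAct_iff` — «solvable at radius `a` with every minimiser `r`-regular» is invariant under level-`k` gauge transformations of the DATA (def-B's
  `ukExists_gaugeAct_iff'` ∕ `isBackground_gaugeAct_toMS'` ∕ `gaugeAct_mem_bgReg'`); `firstForm_critCfgAxOfRecord_iff` (the named letter is a gauge image of the bare one).
* §4 ★★★ `firstForm_of_chiFix29Ax_of_lipschitz` — THE Ax COLLAR: g20's `firstForm_of_chiFix29_of_lipschitz` VERBATIM except `hz : chiFix29AxOfRecord … V ≠ 0`; reference field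
  `V^{(k)}_{ax}(V̄) = axialize (V^{(k)}(V̄))` (first-form by §3 from g20's `isBackground_restrict_and_uniqueUkOrbit_of_slots`), closeness off `b₀` by (2.9)-Ax, at `b₀` by §2, then the
  displayed LIPSCHITZ row `hLip` ([15] Prop. 9 species) — CONDITIONAL on `hLip` and the slots `hT1`∕`hUk`∕`h11`, exactly as the bare collar.

HONEST FRAMING (binding).  Count-neutral kernel bookkeeping BY NAME; [B11] Thm 1 ∕ Prop. 9 enter ONLY as the displayed slots `hT1`∕`hUk`∕`h11`∕`hLip`; nothing of Bałaban's analysis asserted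
or discharged; no body of record edited, no name re-pointed; the Ax doors themselves are NOT re-issued here (they wait on the Ax re-pins of the witness θ-families — census finding (1) —
and on DEF-1's Ax door leaf); N07 ∕ N09 NOT discharged; K0ᴬ 27238 ∕ K1ᴬ 27239 ∕ K3ᴬ 27247 OPEN; counts unmoved (8∕28 · K 1∕4); R4 = the CONDITIONAL finite-𝕋⁴ rung `BalabanLadder.UV`
only — NOT ℝ⁴ ∕ OS; the Yang–Mills mass gap (Clay) is NOT proved by any of this.
-/

noncomputable section

open MeasureTheory Set
open scoped Matrix.Norms.L2Operator

namespace Summit.QuantumFields.YangMills.BalabanUVNodes.K0BetaAxRiderCollar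

open Literature.MathematicalPhysics.QuantumFieldTheory.Balaban1983to89
open Literature.MathematicalPhysics.QuantumFieldTheory.Balaban1983to89.Node00
open Literature.MathematicalPhysics.QuantumFieldTheory.Balaban1983to89.T4Continuum (T4Family)
open Literature.MathematicalPhysics.QuantumFieldTheory.Balaban1983to89.ExpMeanLog (deltaSU deltaSU_pos)
open Literature.MathematicalPhysics.QuantumFieldTheory.Balaban1983to89.B12GaugeOrbits021 (OrbitRel)
open BlockAxialRepresentative (axializer axialize axialize_def)
open B15Eq177GaugeInvariance (blockLift toMS_blockLift_self)
open B16Sect1Backgrounds (toMS)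
open B12RTGaugeInvariance254 (invTransf gaugeAct_inv_gaugeAct)
open GaugeField (gaugeAct)
open Summit.QuantumFields.YangMills.BalabanUVNodes.N07CritCfgAxOfRecordClauses (plaqSmall_critCfgAxOfRecord_of_ukExists)
open Summit.QuantumFields.YangMills.BalabanUVNodes.N09LocalSupportSetAnyCrit (dist1_b0_le_of_thresholds)
open Summit.QuantumFields.YangMills.BalabanUVNodes.N09BackgroundRadiiTransfer (bgReg_mono mem_bgReg_iff_of_orbitRel)
open Summit.QuantumFields.YangMills.BalabanUVNodes.K0TwoPrimeOfFixedRadiusBoxThm1Slots (h53a_at h53b_at eta_succ_sq isBackground_restrict_and_uniqueUkOrbit_of_slots)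
open Summit.QuantumFields.YangMills.BalabanUVNodes.K0TwoPrimeOfMembershipDomain (cast_L_pow_d_sub_one plaqSmall_two_mul_of_firstForm)
open Summit.QuantumFields.YangMills.BalabanUVNodes.K0TwoPrimeOfLipschitzCollar (rider_eps_eq rider_inner_eq)

variable {F : T4Family} {N : ℕ} [NeZero N]

/-! ## §1  The named centre and its cut-offs read the numerics carrier only through `εreg` -/

/-- `V^{(k)}_{ax}` reads `ν` only through `ν.εreg` (the radius inside `U_{k+1}(ν.εreg; ·)`). [cite: Balaban1987RG1, (2.3) p.265 (bookkeeping)] -/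
theorem critCfgAxOfRecord_congr_εreg {ν ν' : Stage7Numerics} (h : ν.εreg = ν'.εreg) (K k : ℕ) :
    critCfgAxOfRecord F N ν K k = critCfgAxOfRecord F N ν' K k := by
  funext W
  rw [critCfgAxOfRecord_def, critCfgAxOfRecord_def, critCfgOfRecord_def, critCfgOfRecord_def, h]

/-- The axial-centred fluctuation deviation reads `ν` only through `ν.εreg`. [cite: Balaban1987RG1, (2.9) p.266 (bookkeeping)] -/
theorem fluctDevAxOfRecord_congr_εreg {ν ν' : Stage7Numerics} (h : ν.εreg = ν'.εreg) (K k : ℕ) :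
    fluctDevAxOfRecord F N ν K k = fluctDevAxOfRecord F N ν' K k := by
  funext V b
  rw [fluctDevAxOfRecord_apply, fluctDevAxOfRecord_apply, critCfgAxOfRecord_congr_εreg h]

/-- ★ **`χ^{(2.9)}_{ax}` READS ITS NUMERICS CARRIER ONLY THROUGH `ν.εreg`** — the Ax twin of g20's `chiFix29OfRecord_congr_εreg`. [cite: Balaban1987RG1, (2.3) p.265 and (2.9) p.266 (bookkeeping)] -/
theorem chiFix29AxOfRecord_congr_εreg {ν ν' : Stage7Numerics} (h : ν.εreg = ν'.εreg) (ε₁ : ℝ) (K k : ℕ) :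
    chiFix29AxOfRecord F N ν ε₁ K k = chiFix29AxOfRecord F N ν' ε₁ K k := by
  funext V
  unfold chiFix29AxOfRecord
  rw [fluctDevAxOfRecord_congr_εreg h]

/-- The β-slot family `chiFixed29Ax` reads `ν` only through `ν.εreg`. [cite: Balaban1987RG1, (2.9) p.266 (bookkeeping)] -/
theorem chiFixed29Ax_congr_εreg {ν ν' : Stage7Numerics} (h : ν.εreg = ν'.εreg) (ε₁ : ℝ) (K : ℕ) (g : ℕ → ℝ) (k : ℕ) :
    chiFixed29Ax F N ν ε₁ K g k = chiFixed29Ax F N ν' ε₁ K g k := by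
  rw [chiFixed29Ax_apply, chiFixed29Ax_apply, chiFix29AxOfRecord_congr_εreg h]

/-! ## §2  The Ax RIDER: distinguished bond variables follow the others -/

/-- ★★ **THE p. 266–267 RIDER AT THE NAMED BLOCK-AXIAL CENTRE** (`k < K`): if `Ū U` is solvable at radius `ν.εreg` and `χ^{(2.9)}_{k,ax}(U) = 1` at threshold `ε₁ ≥ 0`, then at every
distinguished bond `b₀(c)` `fluctDevAx U b₀ ≤ 10·((d+2)L)·ε₁·L^{d−1}` — dag-n09-w3 g6's letter-parametric `dist1_b0_le_of_thresholds` at `crit := critCfgAxOfRecord ν K k`, fed by PT-A-2's fibre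
identity `avg_critCfgAxOfRecord` and file 1's Prop-2 smallness (radius `δ := 2εreg∕L²`; numerics: the rider's two at that `δ`, `0 < εreg`, the (53) pair at `εreg`).
[cite: Balaban1987RG1, (2.3) p.265, (2.9) p.266 and p.267; Balaban1985Averaging, Prop. 2 (53) p.26 and (19) p.21] -/
theorem fluctDevAx_b0_le_of_chiFix29Ax_eq_one (ν : Stage7Numerics) {K k : ℕ} (hk : k < K) {ε₁ : ℝ} (hε : 0 ≤ ε₁) (hεreg : 0 < ν.εreg)
    (hε3 : (143 * (((((F.P K).d + 4 : ℕ) : ℝ)) ^ 2 / 4) ^ 2) * ν.εreg ≤ 1 / 3)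
    (hε2 : 2 * ν.εreg ≤ 2 * deltaSU (Fin N) / ((((F.P K).d + 4) * (F.P K).L : ℕ) : ℝ) ^ 2)
    (hn1 : 1640 * (2 * (((((F.P K).d + 2) * (F.P K).L : ℕ) : ℝ) * ε₁) + ((((F.P K).d + 2) * (F.P K).L : ℕ) : ℝ) ^ 2 / 4 * (2 * ν.εreg / ((F.P K).L : ℝ) ^ 2)) *
      (((F.P K).L : ℝ) ^ ((F.P K).d - 1)) ^ 2 ≤ 1)
    (hn2 : 13 * (2 * (((((F.P K).d + 2) * (F.P K).L : ℕ) : ℝ) * ε₁) + ((((F.P K).d + 2) * (F.P K).L : ℕ) : ℝ) ^ 2 / 4 * (2 * ν.εreg / ((F.P K).L : ℝ) ^ 2)) *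
      ((F.P K).L : ℝ) ^ ((F.P K).d - 1) < deltaSU (Fin N))
    {U : GaugeField (F.P K) k (SU N)} (hsol : UkExists F N K (k + 1) ν.εreg ((avOfRecord F N K k).avg U)) (hχ : chiFix29AxOfRecord F N ν ε₁ K k U = 1) :
    ∀ b : PBond (F.P K) k, IsB0 b →
      fluctDevAxOfRecord F N ν K k U b ≤ 10 * (((((F.P K).d + 2) * (F.P K).L : ℕ) : ℝ) * ε₁) * ((F.P K).L : ℝ) ^ ((F.P K).d - 1) := by
  have hk1 : k + 1 ≤ (F.P K).m + (F.P K).K := by simp only [T4Family.P_K]; omega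
  have hL0 : (0 : ℝ) < (F.P K).L := by exact_mod_cast (F.P K).L_pos
  have hδ0 : 0 ≤ 2 * ν.εreg / ((F.P K).L : ℝ) ^ 2 := by positivity
  have havg : (avOfRecord F N K k).avg (critCfgAxOfRecord F N ν K k ((avOfRecord F N K k).avg U)) = (avOfRecord F N K k).avg U :=
    avg_critCfgAxOfRecord hk1 hsol
  have hcritδ : PlaqSmall (2 * ν.εreg / ((F.P K).L : ℝ) ^ 2) (critCfgAxOfRecord F N ν K k ((avOfRecord F N K k).avg U)) :=
    plaqSmall_critCfgAxOfRecord_of_ukExists ν hεreg hε3 hε2 (by rw [div_mul_cancel₀ _ (by positivity)]) hsol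
  have hoff : ∀ b : PBond (F.P K) k, ¬ IsB0 b → dist1 ((critCfgAxOfRecord F N ν K k ((avOfRecord F N K k).avg U) b)⁻¹ * U b) < ε₁ := fun b hb => by
    rw [← fluctDevAxOfRecord_apply]; exact (chiFix29AxOfRecord_eq_one_iff ν ε₁ K k U).1 hχ b hb
  intro b hb
  rw [fluctDevAxOfRecord_apply]
  exact dist1_b0_le_of_thresholds (critCfgAxOfRecord F N ν K k) hk hε hδ0 hn1 hn2 havg hcritδ hoff b hb

/-- ★★ **THE Ax RIDER IN THE STAGE-13 CURRENCY** — g21's `hb0_at_of_hsol_of_numerics` with `χβ := chiβOfRecord₁₃Ax` ([Ax-3a]) and the deviation centred at `V^{(j)}_{ax}`: ONE step `j < K`,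
ONE field `U`, solvability AT its average only. [cite: Balaban1987RG1, (2.3) p.265, (2.9) p.266 and p.267; Balaban1985Averaging, Prop. 2 (53) p.26] -/
theorem hb0Ax_at_of_hsol_of_numerics (θ₀ : Stage13Params F N) (K : ℕ) (g : ℕ → ℝ) (hεreg : 0 < θ₀.ν.εreg)
    (hε3 : (143 * (((((F.P K).d + 4 : ℕ) : ℝ)) ^ 2 / 4) ^ 2) * θ₀.ν.εreg ≤ 1 / 3)
    (hε2 : 2 * θ₀.ν.εreg ≤ 2 * deltaSU (Fin N) / ((((F.P K).d + 4) * (F.P K).L : ℕ) : ℝ) ^ 2) (hε29 : 0 ≤ θ₀.ε₂₉)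
    (hn1 : 1640 * (2 * (((((F.P K).d + 2) * (F.P K).L : ℕ) : ℝ) * θ₀.ε₂₉) +
        ((((F.P K).d + 2) * (F.P K).L : ℕ) : ℝ) ^ 2 / 4 * (2 * θ₀.ν.εreg / ((F.P K).L : ℝ) ^ 2)) * (((F.P K).L : ℝ) ^ ((F.P K).d - 1)) ^ 2 ≤ 1)
    (hn2 : 13 * (2 * (((((F.P K).d + 2) * (F.P K).L : ℕ) : ℝ) * θ₀.ε₂₉) +
        ((((F.P K).d + 2) * (F.P K).L : ℕ) : ℝ) ^ 2 / 4 * (2 * θ₀.ν.εreg / ((F.P K).L : ℝ) ^ 2)) * ((F.P K).L : ℝ) ^ ((F.P K).d - 1) < deltaSU (Fin N))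
    {j : ℕ} (hj : j < K) (U : GaugeField (F.P K) j (SU N))
    (hsol : UkExists F N K (j + 1) θ₀.ν.εreg ((avOfRecord F N K j).avg U)) (hχ : chiβOfRecord₁₃Ax F N θ₀ K g j U = 1) :
    ∀ b : PBond (F.P K) j, IsB0 b →
      fluctDevAxOfRecord F N θ₀.ν K j U b ≤ 10 * (((((F.P K).d + 2) * (F.P K).L : ℕ) : ℝ) * θ₀.ε₂₉) * ((F.P K).L : ℝ) ^ ((F.P K).d - 1) :=
  fluctDevAx_b0_le_of_chiFix29Ax_eq_one θ₀.ν hj hε29 hεreg hε3 hε2 hn1 hn2 hsol (by rw [chiβOfRecord₁₃Ax_apply] at hχ; exact hχ)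

/-! ## §3  «First form» (solvable ∧ every minimiser `r`-regular) is invariant under gauge transformations of the data; the named letter is a gauge image of the bare one -/

/-- **«Solvable at radius `a` with every minimiser `r`-regular» IS INVARIANT UNDER LEVEL-`k` GAUGE TRANSFORMATIONS OF THE DATA** (standing range `k ≤ m + K`): minimisers over `W^v` are the
block-lift images of minimisers over `W` (def-B's `isBackground_gaugeAct_toMS'` with `toMS (blockLift v) = v`), and the class `bgReg r` is gauge invariant.
[cite: Balaban1985Variational, (181) p.307; Balaban1987RG1, (0.21) p.256 and (1.2) p.260] -/
theorem firstForm_gaugeAct_iff {K k : ℕ} (hk : k ≤ (F.P K).m + (F.P K).K) {a r : ℝ} (v : GaugeTransf (F.P K) k (SU N)) (W : GaugeField (F.P K) k (SU N)) :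
    (UkExists F N K k a (gaugeAct v W) ∧ ∀ U₁, IsBackground (avOfRecord F N K) (bgReg F N K k a) k (gaugeAct v W) U₁ → U₁ ∈ bgReg F N K k r) ↔
      (UkExists F N K k a W ∧ ∀ U₁, IsBackground (avOfRecord F N K) (bgReg F N K k a) k W U₁ → U₁ ∈ bgReg F N K k r) := by
  have key : ∀ (v : GaugeTransf (F.P K) k (SU N)) (W : GaugeField (F.P K) k (SU N)),
      (∀ U₁, IsBackground (avOfRecord F N K) (bgReg F N K k a) k W U₁ → U₁ ∈ bgReg F N K k r) →
        ∀ U₁, IsBackground (avOfRecord F N K) (bgReg F N K k a) k (gaugeAct v W) U₁ → U₁ ∈ bgReg F N K k r := by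
    intro v W h U₁ hU₁
    -- pull the minimiser back over `W` with the block lift of `v⁻¹`
    have h' := isBackground_gaugeAct_toMS' (ε := a) hk hU₁ (blockLift k (invTransf v))
    rw [toMS_blockLift_self hk, gaugeAct_inv_gaugeAct] at h'
    have hmem := h _ h'
    have hback := gaugeAct_mem_bgReg' (F := F) (N := N) (K := K) (k := k) (ε := r) (blockLift k (invTransf (invTransf v))) _ hmem
    -- `(U₁^{w})^{w⁻¹…}`: simplify the double inverse by computing bondwise
    have e : gaugeAct (blockLift k (invTransf (invTransf v))) (gaugeAct (blockLift k (invTransf v)) U₁) = U₁ := by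
      have hv : invTransf (invTransf v) = v := by funext x; simp [invTransf]
      rw [hv]
      have hl : blockLift k (invTransf v) = invTransf (blockLift k v) := by funext x; rfl
      rw [hl]
      exact B12RTGaugeInvariance254.gaugeAct_gaugeAct_inv (blockLift k v) U₁
    rw [e] at hback
    exact hback
  refine ⟨fun h => ⟨(ukExists_gaugeAct_iff' hk v W).1 h.1, fun U₁ hU₁ => ?_⟩, fun h => ⟨(ukExists_gaugeAct_iff' hk v W).2 h.1, key v W h.2⟩⟩
  have h2 := key (invTransf v) (gaugeAct v W) h.2
  rw [gaugeAct_inv_gaugeAct] at h2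
  exact h2 U₁ hU₁

/-- **The named block-axial letter is first-form iff the bare critical configuration is** (`V^{(k)}_{ax} = (V^{(k)})^{axializer}`). [cite: Balaban1987RG1, (2.3) p.265; Balaban1985Variational, (181) p.307] -/
theorem firstForm_critCfgAxOfRecord_iff (ν : Stage7Numerics) {K k : ℕ} (hk : k ≤ (F.P K).m + (F.P K).K) {a r : ℝ} (W : GaugeField (F.P K) (k + 1) (SU N)) :
    (UkExists F N K k a (critCfgAxOfRecord F N ν K k W) ∧
        ∀ U₁, IsBackground (avOfRecord F N K) (bgReg F N K k a) k (critCfgAxOfRecord F N ν K k W) U₁ → U₁ ∈ bgReg F N K k r) ↔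
      (UkExists F N K k a (critCfgOfRecord F N ν K k W) ∧
        ∀ U₁, IsBackground (avOfRecord F N K) (bgReg F N K k a) k (critCfgOfRecord F N ν K k W) U₁ → U₁ ∈ bgReg F N K k r) := by
  rw [critCfgAxOfRecord_def, axialize_def]
  exact firstForm_gaugeAct_iff hk _ _

/-! ## §4  The Ax COLLAR: a field in the support of `χ^{(2.9)}_{ax}` over a first-form average is first-form -/

/-- ★★★ **THE COLLAR ROW (hS) AT THE NAMED BLOCK-AXIAL CENTRE FROM LIPSCHITZ STABILITY OF THE FIRST FORM + THE Ax RIDER + THE SLOTS** — member `(K, k)`, `k < K`, radius `a`,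
membership `ρ`, threshold `δ₁₁`: if `V̄` is first-form at level `k+1` (radius `a`, membership `ρ`) and `χ^{(2.9)}_{k,a,ax}(V) ≠ 0`, then `V` is first-form at level `k`.  ROAD = g20's
`firstForm_of_chiFix29_of_lipschitz` with the reference field `V^{(k)}_{ax}(V̄) = axialize (Ū^k(U_{k+1}(a; V̄)))` (first-form of membership `ρ∕L²` by g20 file 1's
`isBackground_restrict_and_uniqueUkOrbit_of_slots` + §3), closeness off `b₀` by (2.9)-Ax (definitional), at `b₀` by §2 (no `h11` needed there), then the displayed LIPSCHITZ row
`hLip` at `(V, V^{(k)}_{ax}, t = 60L⁴ε₂₉, r = ρ∕L²)`.  CONDITIONAL on `hLip` ([15] Prop. 9 species) and the slots; nothing of Bałaban's asserted.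
[cite: Balaban1987RG1, (2.3) p.265, (2.9) p.266 and p.267, (1.1)–(1.2) p.260; Balaban1985Variational, Prop. 9 p.309, (181)–(182) p.307, Thm 1 (6),(8)–(10) p.279; Balaban1985Averaging, Prop. 2 (53) p.26] -/
theorem firstForm_of_chiFix29Ax_of_lipschitz (K k : ℕ) (hk : k < K) {a ρ δ₁₁ α₀ α₁ B tL rL BL ε₂₉ : ℝ}
    (ha : 0 < a) (haα : a ≤ α₀) (hB : 0 ≤ B) (ha53a : 143 * 256 * a ≤ 1 / 3) (ha53b : 2 * a ≤ 2 * deltaSU (Fin N) / (8 * (F.L : ℝ)) ^ 2)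
    (hρ : 0 < ρ) (h53a : 143 * 256 * ρ ≤ 1 / 3) (h53b : 2 * ρ ≤ 2 * deltaSU (Fin N) / (8 * (F.L : ℝ)) ^ 2)
    (hδ : 2 * ρ ≤ δ₁₁) (hα₁ : 2 * ρ ≤ α₁) (hBρ : 2 * B * ρ ≤ a) (hε29 : 0 ≤ ε₂₉)
    (hn1 : 1640 * (12 * (F.L : ℝ) * ε₂₉ + 18 * a) * (F.L : ℝ) ^ 6 ≤ 1) (hn2 : 13 * (12 * (F.L : ℝ) * ε₂₉ + 18 * a) * (F.L : ℝ) ^ 3 < deltaSU (Fin N))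
    (htL : 60 * (F.L : ℝ) ^ 4 * ε₂₉ ≤ tL) (hrL : ρ / (F.L : ℝ) ^ 2 ≤ rL) (hLρ : ρ / (F.L : ℝ) ^ 2 + BL * (60 * (F.L : ℝ) ^ 4 * ε₂₉) ≤ ρ)
    (hT1 : ∀ ε₁ : ℝ, 0 < ε₁ → ε₁ ≤ α₁ → ∀ V : GaugeField (F.P K) k (SU N), PlaqSmall ε₁ V →
      (∃ U : GaugeField (F.P K) 0 (SU N), IsBackground (avOfRecord F N K) {U | InUkClassB11 F N K k (B * ε₁) U} k V U) ∧
      (∀ ε₀ : ℝ, B * ε₁ ≤ ε₀ → ε₀ ≤ α₀ → ∀ U U' : GaugeField (F.P K) 0 (SU N),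
          IsBackground (avOfRecord F N K) {U | InUkClassB11 F N K k (B * ε₁) U} k V U →
          IsBackground (avOfRecord F N K) {U | InUkClassB11 F N K k ε₀ U} k V U' → InUkClassB11 F N K k ε₀ U ∧ OrbitRel k U U'))
    (hUk : ∀ (V : GaugeField (F.P K) k (SU N)) (δ : ℝ), 0 < δ → δ ≤ α₁ → B * δ ≤ a → PlaqSmall δ V →
      UkExists F N K k a V ∧ InUkClassB11 F N K k a (Uk F N K k a V))
    (h11 : ∀ V : GaugeField (F.P K) k (SU N), PlaqSmall δ₁₁ V → UkExists F N K k a V ∧ UniqueUkOrbit F N K k a V)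
    (hLip : ∀ (V V' : GaugeField (F.P K) k (SU N)) (t r : ℝ), 0 ≤ t → t ≤ tL → 0 < r → r ≤ rL →
      (∀ b, dist1 ((V' b)⁻¹ * V b) ≤ t) →
      (UkExists F N K k a V' ∧ ∀ U₁, IsBackground (avOfRecord F N K) (bgReg F N K k a) k V' U₁ → U₁ ∈ bgReg F N K k r) →
      (UkExists F N K k a V ∧ ∀ U₁, IsBackground (avOfRecord F N K) (bgReg F N K k a) k V U₁ → U₁ ∈ bgReg F N K k (r + BL * t)))
    {V : GaugeField (F.P K) k (SU N)}
    (hW : UkExists F N K (k + 1) a ((avOfRecord F N K k).avg V) ∧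
      ∀ U₁, IsBackground (avOfRecord F N K) (bgReg F N K (k + 1) a) (k + 1) ((avOfRecord F N K k).avg V) U₁ → U₁ ∈ bgReg F N K (k + 1) ρ)
    (hz : chiFix29AxOfRecord F N (numerics7OfThm1CCM F.L 0 δ₁₁ 0 0 a 0) ε₂₉ K k V ≠ 0) :
    UkExists F N K k a V ∧ ∀ U₁, IsBackground (avOfRecord F N K) (bgReg F N K k a) k V U₁ → U₁ ∈ bgReg F N K k ρ := by
  -- the numerics carrier (`εreg = a`, `ε₀ = δ₁₁` — both `rfl`)
  set ν : Stage7Numerics := numerics7OfThm1CCM F.L 0 δ₁₁ 0 0 a 0 with hν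
  have hreg : ν.εreg = a := rfl
  have hk1 : k + 1 ≤ (F.P K).m + (F.P K).K := by simp only [T4Family.P_K]; omega
  have hkr : k ≤ (F.P K).m + (F.P K).K := Nat.le_of_succ_le hk1
  have hL1 : (1 : ℝ) ≤ (F.L : ℝ) := by exact_mod_cast F.hL.2.le
  have hL0 : (0 : ℝ) < (F.L : ℝ) := by linarith
  obtain ⟨hexW, hregW⟩ := hW
  -- the BARE reference field `V^{(k)} = Ū^k(U_{k+1}(a; V̄))` is first-form of membership `ρ∕L²` (g20 file 1)
  have hL2 : (1 : ℝ) ≤ (F.L : ℝ) ^ 2 := one_le_pow₀ hL1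
  have hδL : 2 * ρ ≤ δ₁₁ * (F.L : ℝ) ^ 2 := hδ.trans (le_mul_of_one_le_right (by linarith) hL2)
  have hα₁L : 2 * ρ ≤ α₁ * (F.L : ℝ) ^ 2 := hα₁.trans (le_mul_of_one_le_right (by linarith) hL2)
  obtain ⟨hR, hQ⟩ := isBackground_restrict_and_uniqueUkOrbit_of_slots K k ha haα hρ h53a h53b hδL hα₁L hB hBρ hT1 hUk h11 hexW hregW
  have hmem' : Uk F N K (k + 1) a ((avOfRecord F N K k).avg V) ∈ bgReg F N K k (ρ / (F.L : ℝ) ^ 2) := by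
    have h := hregW _ (isBackground_Uk hexW)
    rw [mem_bgReg_iff] at h ⊢
    intro p
    have hp := h p
    rw [eta_succ_sq] at hp
    calc dist1 (GaugeField.plaqHol (Uk F N K (k + 1) a ((avOfRecord F N K k).avg V)) p) < ρ * ((F.P K).eta k ^ 2 / (F.L : ℝ) ^ 2) := hp
      _ = ρ / (F.L : ℝ) ^ 2 * (F.P K).eta k ^ 2 := by ring
  have hff : UkExists F N K k a (critCfgOfRecord F N ν K k ((avOfRecord F N K k).avg V)) ∧
      ∀ U₁, IsBackground (avOfRecord F N K) (bgReg F N K k a) k (critCfgOfRecord F N ν K k ((avOfRecord F N K k).avg V)) U₁ →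
        U₁ ∈ bgReg F N K k (ρ / (F.L : ℝ) ^ 2) := by
    rw [critCfgOfRecord_def, hreg]
    exact ⟨⟨_, hR⟩, fun U₁ h₁ => (mem_bgReg_iff_of_orbitRel (hQ _ _ h₁ hR)).2 hmem'⟩
  -- … hence so is the NAMED reference field `V^{(k)}_{ax}(V̄)` (§3)
  have hff' := (firstForm_critCfgAxOfRecord_iff ν hkr ((avOfRecord F N K k).avg V)).2 hff
  -- `χ_{ax} = 1`
  have hχ1 : chiFix29AxOfRecord F N ν ε₂₉ K k V = 1 := (chiFix29AxOfRecord_eq_zero_or_one ν ε₂₉ K k V).resolve_left hz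
  -- bondwise closeness of `V` to `V^{(k)}_{ax}`: non-distinguished bonds by (2.9)-Ax, distinguished ones by the Ax rider (§2) fed by `hexW` alone
  have ht0 : 0 ≤ 60 * (F.L : ℝ) ^ 4 * ε₂₉ := by positivity
  have hε₂₉t : ε₂₉ ≤ 60 * (F.L : ℝ) ^ 4 * ε₂₉ := by
    have h1 : (1 : ℝ) ≤ 60 * (F.L : ℝ) ^ 4 := by nlinarith [one_le_pow₀ (n := 4) hL1]
    nlinarith
  have hexW' : UkExists F N K (k + 1) ν.εreg ((avOfRecord F N K k).avg V) := by rw [hreg]; exact hexW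
  have hclose : ∀ b : PBond (F.P K) k, dist1 ((critCfgAxOfRecord F N ν K k ((avOfRecord F N K k).avg V) b)⁻¹ * V b) ≤ 60 * (F.L : ℝ) ^ 4 * ε₂₉ := by
    intro b
    rw [← fluctDevAxOfRecord_apply]
    by_cases hb : IsB0 b
    · have h := fluctDevAx_b0_le_of_chiFix29Ax_eq_one ν hk hε29 (by rw [hreg]; exact ha) (by rw [hreg]; exact h53a_at K ha53a)
        (by rw [hreg]; exact h53b_at K ha53b) (by rw [hreg, rider_inner_eq, cast_L_pow_d_sub_one, ← pow_mul]; exact hn1)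
        (by rw [hreg, rider_inner_eq, cast_L_pow_d_sub_one]; exact hn2) hexW' hχ1 b hb
      rw [rider_eps_eq] at h
      exact h
    · exact (((chiFix29AxOfRecord_eq_one_iff ν ε₂₉ K k V).1 hχ1) b hb).le.trans hε₂₉t
  -- the Lipschitz row at `(V, V^{(k)}_{ax}(V̄), 60L⁴ε₂₉, ρ∕L²)`
  have hρL2 : 0 < ρ / (F.L : ℝ) ^ 2 := by positivity
  obtain ⟨hexV, hregV⟩ := hLip V _ (60 * (F.L : ℝ) ^ 4 * ε₂₉) (ρ / (F.L : ℝ) ^ 2) ht0 htL hρL2 hrL hclose hff'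
  exact ⟨hexV, fun U₁ h₁ => bgReg_mono hLρ (hregV U₁ h₁)⟩

end Summit.QuantumFields.YangMills.BalabanUVNodes.K0BetaAxRiderCollar
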